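import Mathlib
import Literature.Probability.RandomPlanarGeometry.CurveSpace
import Literature.Probability.RandomPlanarGeometry.SimpleCurves
import Literature.Probability.RandomPlanarGeometry.PolylineSimple
import Literature.Probability.RandomPlanarGeometry.PlanarDomains
import Literature.Probability.LatticeModels.LatticeInterface
import HarnessLib

/-!
# The critical freely-jointed non-crossing chain (off-lattice planar SAW) and its two-point law

Topic `Literature/Probability/RandomPlanarGeometry`; definition request `FreelyJointedSAW.law`
(route `SAWIsotropicAnchor` of `Summits/CriticalPhenomena/SAWScalingLimit`, items
`stmt-CriticalPhenomena-7297/7299/7300/7301`, where the law is inlined as `let fjc := …`).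

The **freely-jointed chain** (Kuhn's model; with excluded volume: Baumgärtner–Binder, J. Chem.
Phys. 71 (1979)) is the off-lattice analogue of the lattice self-avoiding walk: a planar polygonal
path `v₀, v₁, …, v_N` with steps `v_{k+1} - v_k = ℓ e^{iθ_k}` of FIXED length `ℓ` and i.i.d.
Haar-uniform directions `θ_k ∈ [0, 2π)`, conditioned to be non-crossing (its polyline is a simple
curve). Exactly as for the lattice SAW (Madras–Slade 1993, §1.2; Lawler–Schramm–Werner 2004,
§3.1) the probabilities `p_N = P[the N-step unit chain is simple]` are supermultiplicative-free /
submultiplicative (`p_{N+M} ≤ p_N p_M`), so `μ_fjc := inf_N p_N^{1/N} = lim_N p_N^{1/N} ∈ [0, 1]`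
plays the role of (connective constant)/(2π) and `1/μ_fjc` is the critical step fugacity. The
**critical two-point law** `FreelyJointedSAW.law ℓ Ω x y` is the off-lattice transcription of the
boundary-to-boundary measure `m^#(z, w; D)` of Lawler–Schramm–Werner 2004, §3.4.2 (the measure
`μ_SAW = μ^{-|ω|}` restricted to SAWs of the domain between two points, normalised): chains started
uniformly in the ball `B(x, ℓ)`, weighted `μ_fjc^{-N} (2π)^{-N} dθ` (grand-canonical in the number
of steps `N`, AT the critical fugacity), restricted at configuration level to
{simple, trace inside `closure Ω`, endpoint in `B(y, ℓ)`}, pushed forward to the space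
`CurveClass ℂ` of curves modulo reparametrisation, summed over `N` and normalised by the total
mass (junk value `0` when the mass is `0` or `∞`, as for `SAW.law`).

## Contents

* `FreelyJointedSAW.steps N θ k = ∑_{j<k} e^{iθ_j}` (vertices of the unit chain from `0`),
  `FreelyJointedSAW.curveOf N v` (the polyline class through `v : Fin (N+1) → ℂ`),
  `FreelyJointedSAW.simpleProb N = p_N`, `FreelyJointedSAW.connectiveConstant = μ_fjc`,
  `FreelyJointedSAW.chainCurve ℓ N (z, θ)` (configuration ↦ curve class),
  `FreelyJointedSAW.admissible ℓ Ω y` (the conditioning event), `FreelyJointedSAW.configMeasure`,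
  `FreelyJointedSAW.weight` (the unnormalised critical measure `W`) and `FreelyJointedSAW.law`.
* `FreelyJointedSAW.law_eq_fjc` — `law` is, by `rfl`, the term inlined in the route items.
* Continuity / measurability of the configuration maps (`continuous_curveOf`,
  `continuous_chainCurve`, `measurable_chainCurve`, from `Polyline.continuous_polyline_ofFn` of
  `PolylineSimple.lean`), so that the `Measure.map` in the definition is not junk; measurability
  of `admissible` (`CurveClass.measurableSet_simple'` of `SimpleCurves.lean`).
* `weight_apply`, `isProbabilityMeasure_law_iff` (`law` is a probability measure iff
  `0 < W univ < ∞`), the junk cases `law_eq_zero_of_weight_univ_eq_zero/…_eq_top`.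
* Restriction as conditioning (LSW 2004, §3.4.5): for `Ω' ⊆ Ω`,
  `weight ℓ Ω' x y = (weight ℓ Ω x y).restrict (rangeSubset (closure Ω'))`,
  `law ℓ Ω' x y = (weight ℓ Ω x y)[|rangeSubset (closure Ω')]` and the product form
  `law ℓ Ω' x y T * law ℓ Ω x y R = law ℓ Ω x y (T ∩ R)`, `R = rangeSubset (closure Ω')`.
* `FreelyJointedSAW.IsApprox D a′ b′` — admissible chain approximations of the marked points of
  a Dobrushin domain (`a′(ℓ) → a`, `b′(ℓ) → b`, the law eventually a probability measure): the
  hypothesis shape quantified in the route items, by `Iff.rfl` (`isApprox_iff`).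
* `1/4 ≤ μ_fjc ≤ 1`, in particular `0 < μ_fjc` (`one_quarter_le_connectiveConstant`,
  `connectiveConstant_pos`, `connectiveConstant_le_one`): the cone bound `p_N ≥ 4^{-N}` — if all
  direction angles lie in `[0, π/2)` the real parts of the vertices increase strictly, and such a
  polyline is a simple class (`Polyline.mk_polyline_ofFn_mem_simple`, via flatness of the dyadic
  parametrisation and the monotone–light factorisation of `SimpleCurves.lean`).

## Design

The body of `law` is dictated by the route items (so that they re-sign by `rfl`); in particular
the polyline is the tree's `LatticeModels.polyline` (dyadic `Path.trans` parametrisation with a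
constant tail — immaterial modulo reparametrisation: `CurveClass.simple` asks for SOME injective
representative), the angles live in `[0, 2π)^N ⊆ ℝ^N` with Lebesgue measure, and `μ_fjc` is an
infimum (Fekete form), not a limit. Deliberately NOT here: the Euclidean/scaling covariance and
reversal identities of `law` (follow-up file), the confinement lemma (finite mass in bounded
domains), the stiff (von Mises) and worm-like (Kratky–Porod) variants.

## References

* G. F. Lawler, O. Schramm, W. Werner, *On the scaling limit of planar self-avoiding walk*, Proc.
  Sympos. Pure Math. 72.2 (2004), §3.1, §3.4.2 (the measures `m^#(z,w;D)`), §3.4.5 (restriction).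
  [LawlerSchrammWerner2004SAW]
* N. Madras, G. Slade, *The Self-Avoiding Walk* (1993), §1.2, (1.2.3)–(1.2.5) and Lemma 1.2.2
  (subadditivity, connective constant). [MadrasSlade1993]
* A. Baumgärtner, K. Binder, *Monte Carlo studies on the freely jointed polymer chain with excluded
  volume interaction*, J. Chem. Phys. 71 (1979) 2541–2545. [BaumgartnerBinder1979]
-/

noncomputable section

open MeasureTheory Set Filter Function
open scoped ENNReal NNReal unitInterval Topology ProbabilityTheory

namespace Literature.Probability.RandomPlanarGeometry

namespace FreelyJointedSAW

open Literature.Probability.LatticeModels (polyline)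
open Polyline (continuous_polyline_ofFn mk_polyline_ofFn_mem_simple)

/-! ### The unit chain: vertices, polyline class, simplicity probability, `μ_fjc` -/

/-- The vertices of the UNIT freely-jointed chain from the origin with direction angles
`θ : Fin N → ℝ`: `steps N θ k = ∑_{j < k} e^{i θ_j}`, `k = 0, …, N` (so `steps N θ 0 = 0`).
(Baumgärtner–Binder 1979: freely jointed chain, fixed bond length, free bond angles.)
[cite: BaumgartnerBinder1979, §II (the model)] -/
def steps (N : ℕ) (θ : Fin N → ℝ) (k : Fin (N + 1)) : ℂ :=
  ∑ j : Fin N, if (j : ℕ) < (k : ℕ) then Complex.exp (Complex.I * (θ j : ℂ)) else 0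

/-- The polygonal curve through the vertices `v 0, …, v N`, modulo reparametrisation: the class
in `CurveClass ℂ` of the tree's polyline `LatticeModels.polyline [v 0, …, v N]`
(LSW 2004, §3.4.2: "we may use any parametrization of this curve"). [cite: LawlerSchrammWerner2004SAW, §3.4.2] -/
def curveOf (N : ℕ) (v : Fin (N + 1) → ℂ) : CurveClass ℂ :=
  CurveClass.mk ⟨polyline (List.ofFn v)⟩

/-- `p_N`, the probability that the `N`-step unit freely-jointed chain with i.i.d. uniform
directions is non-crossing (its polyline class is simple): the Lebesgue measure of the simple
configurations in `[0, 2π)^N`, divided by `(2π)^N`. The off-lattice analogue of `c_N / (2d)^N`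
(Madras–Slade 1993, §1.2). [cite: MadrasSlade1993, §1.2] -/
def simpleProb (N : ℕ) : ℝ :=
  ((volume : Measure (Fin N → ℝ)) {θ | (∀ j, θ j ∈ Set.Ico (0 : ℝ) (2 * Real.pi)) ∧
    curveOf N (steps N θ) ∈ CurveClass.simple}).toReal / (2 * Real.pi) ^ N

/-- `μ_fjc := inf_{N ≥ 1} p_N^{1/N}`, the exponential rate of the non-crossing probabilities of
the freely-jointed chain — the off-lattice connective constant divided by `2π`. By
submultiplicativity `p_{N+M} ≤ p_N p_M` and Fekete's lemma (Madras–Slade 1993, (1.2.3)–(1.2.5),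
Lemma 1.2.2) the infimum is the limit; the definition takes the infimum.
[cite: MadrasSlade1993, §1.2 Lemma 1.2.2] -/
def connectiveConstant : ℝ :=
  ⨅ N : ℕ, simpleProb (N + 1) ^ (1 / ((N : ℝ) + 1))

/-- The configuration-to-curve map at step length `ℓ`: the configuration `(z, θ)` (starting point
and `N` direction angles) is sent to the polyline class through the vertices
`v_k = z + ℓ ∑_{j<k} e^{iθ_j}`. [cite: BaumgartnerBinder1979, §II] -/
def chainCurve (ℓ : ℝ) (N : ℕ) (p : ℂ × (Fin N → ℝ)) : CurveClass ℂ :=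
  curveOf N (fun k => p.1 + (ℓ : ℂ) * steps N p.2 k)

/-- The conditioning event of the two-point law: simple curve classes whose trace lies in
`closure Ω` and whose endpoint lies in the ball `B(y, ℓ)` (LSW 2004, §3.4.2: SAWs of the domain
ending near the target point). [cite: LawlerSchrammWerner2004SAW, §3.4.2] -/
def admissible (ℓ : ℝ) (Ω : Set ℂ) (y : ℂ) : Set (CurveClass ℂ) :=
  {c | c ∈ CurveClass.simple ∧ c.range ⊆ closure Ω ∧ c.target ∈ Metric.ball y ℓ}

/-- The a-priori configuration measure of the `N`-step chain at step length `ℓ` started near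
`x`: Lebesgue measure on the ball `B(x, ℓ)` for the starting point times Lebesgue measure on the
angle box `[0, 2π)^N` (unnormalised Haar directions). [folklore] -/
def configMeasure (ℓ : ℝ) (x : ℂ) (N : ℕ) : Measure (ℂ × (Fin N → ℝ)) :=
  (volume.restrict (Metric.ball x ℓ)).prod
    (volume.restrict (Set.univ.pi fun _ : Fin N => Set.Ico (0 : ℝ) (2 * Real.pi)))

/-- The **unnormalised critical two-point measure** `W = W(ℓ, Ω, x, y)` of the freely-jointed
non-crossing chain on `CurveClass ℂ`: the sum over the number of steps `N` of
`(μ_fjc⁻¹ / 2π)^N` times the push-forward under `chainCurve ℓ N` of the configuration measure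
restricted to admissible configurations (simple, inside `closure Ω`, ending in `B(y, ℓ)`). The
off-lattice transcription of `μ_SAW = μ^{-|ω|}` restricted to `Λ(z, w; D)`
(LSW 2004, §3.1 and §3.4.2). [cite: LawlerSchrammWerner2004SAW, §3.4.2] -/
def weight (ℓ : ℝ) (Ω : Set ℂ) (x y : ℂ) : Measure (CurveClass ℂ) :=
  Measure.sum fun N : ℕ => ENNReal.ofReal ((connectiveConstant⁻¹ / (2 * Real.pi)) ^ N) •
    (((configMeasure ℓ x N).restrict (chainCurve ℓ N ⁻¹' admissible ℓ Ω y)).map (chainCurve ℓ N))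

/-- The **critical two-point law of the freely-jointed non-crossing chain** (off-lattice planar
SAW with steps of fixed length `ℓ` and i.i.d. Haar-uniform directions) in `Ω` from `B(x, ℓ)` to
`B(y, ℓ)`: the unnormalised measure `weight ℓ Ω x y` divided by its total mass — the off-lattice
analogue of LSW's normalised boundary-to-boundary measure `m^#(z, w; D)` and of `SAW.law`. Junk
value `0` when the total mass is `0` or `∞` (`ENNReal` inversion). This is verbatim the term
`fjc ℓ Ω x y` inlined in the items of route `SAWIsotropicAnchor` (`law_eq_fjc`).
[cite: LawlerSchrammWerner2004SAW, §3.4.2] -/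
def law (ℓ : ℝ) (Ω : Set ℂ) (x y : ℂ) : Measure (CurveClass ℂ) :=
  (weight ℓ Ω x y Set.univ)⁻¹ • weight ℓ Ω x y

/-- `law` is definitionally the `let fjc := …` term inlined in items
`stmt-CriticalPhenomena-7297/7299/7300/7301` of route `SAWIsotropicAnchor` (so that those items
re-sign by `rfl`). [folklore] -/
theorem law_eq_fjc : law = (fun ℓ Ω x y => (let S : (N : ℕ) → (Fin N → ℝ) → Fin (N + 1) → ℂ := fun N θ k => ∑ j : Fin N, if (j : ℕ) < (k : ℕ) then Complex.exp (Complex.I * (θ j : ℂ)) else 0; let C : (N : ℕ) → (Fin (N + 1) → ℂ) → Literature.Probability.RandomPlanarGeometry.CurveClass ℂ := fun _ v => Literature.Probability.RandomPlanarGeometry.CurveClass.mk ⟨Literature.Probability.LatticeModels.polyline (List.ofFn v)⟩; let Z : ℕ → ℝ := fun N => ((MeasureTheory.volume : MeasureTheory.Measure (Fin N → ℝ)) {θ | (∀ j, θ j ∈ Set.Ico (0 : ℝ) (2 * Real.pi)) ∧ C N (S N θ) ∈ Literature.Probability.RandomPlanarGeometry.CurveClass.simple}).toReal / (2 * Real.pi)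 ^ N; let μ : ℝ := ⨅ N : ℕ, Z (N + 1) ^ (1 / ((N : ℝ) + 1)); let V : (N : ℕ) → ℂ × (Fin N → ℝ) → Literature.Probability.RandomPlanarGeometry.CurveClass ℂ := fun N p => C N (fun k => p.1 + (ℓ : ℂ) * S N p.2 k); let E : Set (Literature.Probability.RandomPlanarGeometry.CurveClass ℂ) := {c | c ∈ Literature.Probability.RandomPlanarGeometry.CurveClass.simple ∧ c.range ⊆ closure Ω ∧ c.target ∈ Metric.ball y ℓ}; let W : MeasureTheory.Measure (Literature.Probability.RandomPlanarGeometry.CurveClass ℂ) := MeasureTheory.Measure.sum fun N : ℕ => ENNReal.ofReal ((μ⁻¹ / (2 * Real.pi)) ^ N) • ((((MeasureTheory.volume.restrict (Metric.ball x ℓ)).prod (MeasureTheory.volume.restrict (Set.univ.pi fun _ : Fin N => Set.Ico (0 : ℝ) (2 * Real.pi)))).restrict (V N ⁻¹' E)).map (V N)); (W Set.univ)⁻¹ • W) : ℝ → Set ℂ → ℂ → ℂ → MeasureTheory.Measure (Literature.Probability.RandomPlanarGeometry.CurveClass ℂ)) :=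
  rfl

/-! ### Continuity and measurability of the configuration maps -/

/-- Each vertex of the unit chain depends continuously on the angles. [folklore] -/
@[fun_prop]
theorem continuous_steps (N : ℕ) (k : Fin (N + 1)) : Continuous fun θ : Fin N → ℝ => steps N θ k := by
  unfold steps
  refine continuous_finsetSum _ fun j _ => ?_
  split_ifs
  · fun_prop
  · exact continuous_const

/-- The polyline class through `N + 1` vertices depends continuously on the vertices.
[folklore] -/
@[fun_prop]
theorem continuous_curveOf (N : ℕ) : Continuous (curveOf N) :=
  CurveClass.continuous_mk.comp (Curve.lipschitzWith_mk.continuous.comp (continuous_polyline_ofFn N))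

/-- The configuration-to-curve map is continuous. [folklore] -/
@[fun_prop]
theorem continuous_chainCurve (ℓ : ℝ) (N : ℕ) : Continuous (chainCurve ℓ N) := by
  unfold chainCurve
  refine (continuous_curveOf N).comp (continuous_pi fun k => ?_)
  fun_prop

/-- The configuration-to-curve map is Borel measurable (so the push-forwards in `weight` are
genuine image measures). [folklore] -/
@[fun_prop]
theorem measurable_chainCurve (ℓ : ℝ) (N : ℕ) : Measurable (chainCurve ℓ N) :=
  (continuous_chainCurve ℓ N).measurable

/-- The conditioning event is Borel: simplicity is Borel (`CurveClass.measurableSet_simple'`),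
staying in a closed set is closed, and the endpoint map is continuous. [folklore] -/
theorem measurableSet_admissible (ℓ : ℝ) (Ω : Set ℂ) (y : ℂ) :
    MeasurableSet (admissible ℓ Ω y) := by
  change MeasurableSet (CurveClass.simple ∩ (CurveClass.rangeSubset (closure Ω) ∩
    CurveClass.target ⁻¹' Metric.ball y ℓ))
  exact CurveClass.measurableSet_simple'.inter
    ((CurveClass.measurableSet_rangeSubset isClosed_closure).inter
      (CurveClass.continuous_target.measurable Metric.isOpen_ball.measurableSet))

/-- Admissible configurations form a Borel set of configurations. [folklore] -/
theorem measurableSet_preimage_admissible (ℓ : ℝ) (Ω : Set ℂ) (y : ℂ) (N : ℕ) :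
    MeasurableSet (chainCurve ℓ N ⁻¹' admissible ℓ Ω y) :=
  measurable_chainCurve ℓ N (measurableSet_admissible ℓ Ω y)

/-! ### Values of the unnormalised measure; total mass; when `law` is a probability measure -/

/-- The unnormalised measure of a Borel set of curves: `W(s) = ∑_N (μ_fjc⁻¹/2π)^N ·
Leb{(z, θ) ∈ B(x,ℓ) × [0,2π)^N : chain admissible and in s}`. [cite: LawlerSchrammWerner2004SAW, §3.4.2] -/
theorem weight_apply (ℓ : ℝ) (Ω : Set ℂ) (x y : ℂ) {s : Set (CurveClass ℂ)} (hs : MeasurableSet s) :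
    weight ℓ Ω x y s = ∑' N : ℕ, ENNReal.ofReal ((connectiveConstant⁻¹ / (2 * Real.pi)) ^ N) *
      configMeasure ℓ x N (chainCurve ℓ N ⁻¹' s ∩ chainCurve ℓ N ⁻¹' admissible ℓ Ω y) := by
  rw [weight, Measure.sum_apply _ hs]
  refine tsum_congr fun N => ?_
  rw [Measure.smul_apply, smul_eq_mul, Measure.map_apply (measurable_chainCurve ℓ N) hs,
    Measure.restrict_apply (measurable_chainCurve ℓ N hs)]

/-- Unfolding `law`: the unnormalised measure divided by its total mass. [cite: LawlerSchrammWerner2004SAW, §3.4.2] -/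
theorem law_def (ℓ : ℝ) (Ω : Set ℂ) (x y : ℂ) :
    law ℓ Ω x y = (weight ℓ Ω x y Set.univ)⁻¹ • weight ℓ Ω x y := rfl

/-- Values of `law`. [cite: LawlerSchrammWerner2004SAW, §3.4.2] -/
theorem law_apply (ℓ : ℝ) (Ω : Set ℂ) (x y : ℂ) (s : Set (CurveClass ℂ)) :
    law ℓ Ω x y s = (weight ℓ Ω x y Set.univ)⁻¹ * weight ℓ Ω x y s := by
  rw [law, Measure.smul_apply, smul_eq_mul]

/-- Junk case: if no configuration is admissible (total mass `0`), the law is the zero measure.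
[folklore] -/
theorem law_eq_zero_of_weight_univ_eq_zero {ℓ : ℝ} {Ω : Set ℂ} {x y : ℂ}
    (h : weight ℓ Ω x y Set.univ = 0) : law ℓ Ω x y = 0 := by
  rw [law, Measure.measure_univ_eq_zero.1 h, smul_zero]

/-- Junk case: if the total mass is infinite, the law is the zero measure. [folklore] -/
theorem law_eq_zero_of_weight_univ_eq_top {ℓ : ℝ} {Ω : Set ℂ} {x y : ℂ}
    (h : weight ℓ Ω x y Set.univ = ∞) : law ℓ Ω x y = 0 := by
  rw [law, h, ENNReal.inv_top, zero_smul]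

/-- **`law` is a probability measure iff the critical mass is positive and finite.**
[cite: LawlerSchrammWerner2004SAW, §3.4.2] -/
theorem isProbabilityMeasure_law_iff {ℓ : ℝ} {Ω : Set ℂ} {x y : ℂ} :
    IsProbabilityMeasure (law ℓ Ω x y) ↔
      weight ℓ Ω x y Set.univ ≠ 0 ∧ weight ℓ Ω x y Set.univ ≠ ∞ := by
  rw [isProbabilityMeasure_iff, law_apply]
  refine ⟨fun h => ⟨?_, ?_⟩, fun h => ENNReal.inv_mul_cancel h.1 h.2⟩
  · rintro h0
    rw [h0, mul_zero] at h
    exact zero_ne_one h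
  · rintro ht
    rw [ht, ENNReal.inv_top, zero_mul] at h
    exact zero_ne_one h

/-- `law` is a probability measure iff `0 < W univ < ∞`. [cite: LawlerSchrammWerner2004SAW, §3.4.2] -/
theorem isProbabilityMeasure_law_iff' {ℓ : ℝ} {Ω : Set ℂ} {x y : ℂ} :
    IsProbabilityMeasure (law ℓ Ω x y) ↔
      0 < weight ℓ Ω x y Set.univ ∧ weight ℓ Ω x y Set.univ < ∞ := by
  rw [isProbabilityMeasure_law_iff, pos_iff_ne_zero, lt_top_iff_ne_top]

/-- The law is always a sub-probability measure (total mass `1` or junk `0`); in particular it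
is finite. [folklore] -/
theorem law_univ_le_one (ℓ : ℝ) (Ω : Set ℂ) (x y : ℂ) : law ℓ Ω x y Set.univ ≤ 1 := by
  rw [law_apply]
  exact ENNReal.inv_mul_le_one _

/-- The law is a finite measure. [folklore] -/
instance isFiniteMeasure_law (ℓ : ℝ) (Ω : Set ℂ) (x y : ℂ) : IsFiniteMeasure (law ℓ Ω x y) :=
  ⟨(law_univ_le_one ℓ Ω x y).trans_lt ENNReal.one_lt_top⟩

/-! ### Admissible endpoint approximations -/

/-- An **admissible chain approximation** of the marked points of a Dobrushin domain
`D = (Ω; a, b)`: interior points `a′(ℓ) → a = D.pt 0`, `b′(ℓ) → b = D.pt 1` as `ℓ → 0⁺` such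
that the critical two-point law `law ℓ Ω (a′ ℓ) (b′ ℓ)` is a probability measure for all small
`ℓ > 0`. This is the off-lattice analogue of `SAW.IsEndpointApprox` and exactly the hypothesis
`Tendsto a′ … ∧ Tendsto b′ … ∧ ∀ᶠ ℓ in 𝓝[>] 0, IsProbabilityMeasure (fjc ℓ D.carrier (a′ ℓ) (b′ ℓ))`
quantified in the items of route `SAWIsotropicAnchor` (LSW 2004, §3.4.2 take "lattice points
closest to `Nz, Nw`"; here the approximation is quantified). [cite: LawlerSchrammWerner2004SAW, §3.4.2] -/
def IsApprox (D : DobrushinDomain) (a' b' : ℝ → ℂ) : Prop :=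
  Filter.Tendsto a' (nhdsWithin 0 (Set.Ioi 0)) (nhds (D.pt 0)) ∧
    Filter.Tendsto b' (nhdsWithin 0 (Set.Ioi 0)) (nhds (D.pt 1)) ∧
      ∀ᶠ ℓ in nhdsWithin 0 (Set.Ioi 0), IsProbabilityMeasure (law ℓ D.carrier (a' ℓ) (b' ℓ))

/-- Unfolding `IsApprox` into the conjunction written in the route items. [folklore] -/
theorem isApprox_iff (D : DobrushinDomain) (a' b' : ℝ → ℂ) :
    IsApprox D a' b' ↔
      Filter.Tendsto a' (nhdsWithin 0 (Set.Ioi 0)) (nhds (D.pt 0)) ∧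
        Filter.Tendsto b' (nhdsWithin 0 (Set.Ioi 0)) (nhds (D.pt 1)) ∧
          ∀ᶠ ℓ in nhdsWithin 0 (Set.Ioi 0),
            IsProbabilityMeasure (law ℓ D.carrier (a' ℓ) (b' ℓ)) :=
  Iff.rfl

/-- Along an admissible approximation the critical mass is eventually positive and finite.
[folklore] -/
theorem IsApprox.eventually_weight_univ {D : DobrushinDomain} {a' b' : ℝ → ℂ}
    (h : IsApprox D a' b') :
    ∀ᶠ ℓ in nhdsWithin 0 (Set.Ioi 0),
      0 < weight ℓ D.carrier (a' ℓ) (b' ℓ) Set.univ ∧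
        weight ℓ D.carrier (a' ℓ) (b' ℓ) Set.univ < ∞ :=
  h.2.2.mono fun _ hℓ => isProbabilityMeasure_law_iff'.1 hℓ

/-! ### Restriction as conditioning (LSW 2004, §3.4.5) -/

/-- For `Ω' ⊆ Ω` the admissible curves for `Ω'` are the admissible curves for `Ω` staying in
`closure Ω'`. [cite: LawlerSchrammWerner2004SAW, §3.4.5] -/
theorem admissible_of_subset {Ω Ω' : Set ℂ} (h : Ω' ⊆ Ω) (ℓ : ℝ) (y : ℂ) :
    admissible ℓ Ω' y = admissible ℓ Ω y ∩ CurveClass.rangeSubset (closure Ω') := by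
  ext c
  simp only [admissible, mem_setOf_eq, mem_inter_iff, CurveClass.mem_rangeSubset]
  constructor
  · rintro ⟨h1, h2, h3⟩
    exact ⟨⟨h1, h2.trans (closure_mono h), h3⟩, h2⟩
  · rintro ⟨⟨h1, -, h3⟩, h2⟩
    exact ⟨h1, h2, h3⟩

/-- **Restriction property of the unnormalised measure** (exact, at every step length): for
`Ω' ⊆ Ω`, `W(ℓ, Ω', x, y)` is `W(ℓ, Ω, x, y)` restricted to the curves staying in `closure Ω'`
("by definition, the measures `μ_SAW(z,w;D,N)` satisfy the restriction property", LSW 2004,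
§3.4.5). [cite: LawlerSchrammWerner2004SAW, §3.4.5] -/
theorem weight_of_subset {Ω Ω' : Set ℂ} (h : Ω' ⊆ Ω) (ℓ : ℝ) (x y : ℂ) :
    weight ℓ Ω' x y = (weight ℓ Ω x y).restrict (CurveClass.rangeSubset (closure Ω')) := by
  have hR : MeasurableSet (CurveClass.rangeSubset (closure Ω') : Set (CurveClass ℂ)) :=
    CurveClass.measurableSet_rangeSubset isClosed_closure
  ext s hs
  rw [Measure.restrict_apply hs, weight_apply ℓ Ω' x y hs, weight_apply ℓ Ω x y (hs.inter hR)]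
  refine tsum_congr fun N => ?_
  congr 1
  rw [admissible_of_subset h, preimage_inter, preimage_inter]
  ac_rfl

/-- **Restriction as conditioning**: for `Ω' ⊆ Ω`, the law in `Ω'` is the law of the
unnormalised measure in `Ω` conditioned on staying in `closure Ω'`
(`ProbabilityTheory.cond`). [cite: LawlerSchrammWerner2004SAW, §3.4.5] -/
theorem law_of_subset {Ω Ω' : Set ℂ} (h : Ω' ⊆ Ω) (ℓ : ℝ) (x y : ℂ) :
    law ℓ Ω' x y = (weight ℓ Ω x y)[|CurveClass.rangeSubset (closure Ω')] := by
  rw [law, weight_of_subset h, Measure.restrict_apply_univ, ProbabilityTheory.cond]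

/-- **Restriction property of the law, product form** (the shape used by the route's
`LSWRestrictionFact`): for `Ω' ⊆ Ω`, `R = rangeSubset (closure Ω')` and every set of curves `T`,
`law ℓ Ω' x y T * law ℓ Ω x y R = law ℓ Ω x y (T ∩ R)` — conditioning on `R`, written without
division (both sides vanish in the junk cases). [cite: LawlerSchrammWerner2004SAW, §3.4.5] -/
theorem law_of_subset_mul {Ω Ω' : Set ℂ} (h : Ω' ⊆ Ω) (ℓ : ℝ) (x y : ℂ) (T : Set (CurveClass ℂ)) :
    law ℓ Ω' x y T * law ℓ Ω x y (CurveClass.rangeSubset (closure Ω')) =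
      law ℓ Ω x y (T ∩ CurveClass.rangeSubset (closure Ω')) := by
  have hR : MeasurableSet (CurveClass.rangeSubset (closure Ω') : Set (CurveClass ℂ)) :=
    CurveClass.measurableSet_rangeSubset isClosed_closure
  rw [law_of_subset h, ProbabilityTheory.cond, Measure.smul_apply, smul_eq_mul,
    Measure.restrict_apply' hR, law_apply, law_apply]
  set m := weight ℓ Ω x y Set.univ
  set r := weight ℓ Ω x y (CurveClass.rangeSubset (closure Ω'))
  set q := weight ℓ Ω x y (T ∩ CurveClass.rangeSubset (closure Ω'))
  have hqr : q ≤ r := measure_mono inter_subset_right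
  have hrm : r ≤ m := measure_mono (subset_univ _)
  rcases eq_or_ne r 0 with hr0 | hr0
  · have hq0 : q = 0 := nonpos_iff_eq_zero.1 (hqr.trans_eq hr0)
    simp [hq0]
  rcases eq_or_ne r ∞ with hrt | hrt
  · have hmt : m = ∞ := eq_top_iff.2 (hrt ▸ hrm)
    simp [hrt, hmt]
  · calc r⁻¹ * q * (m⁻¹ * r) = m⁻¹ * q * (r⁻¹ * r) := by ring
      _ = m⁻¹ * q := by rw [ENNReal.inv_mul_cancel hr0 hrt, mul_one]

/-! ### Elementary bounds on `p_N` and `μ_fjc` -/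

/-- `0 ≤ p_N`. [cite: MadrasSlade1993, §1.2] -/
theorem simpleProb_nonneg (N : ℕ) : 0 ≤ simpleProb N :=
  div_nonneg ENNReal.toReal_nonneg (pow_nonneg (by positivity) _)

/-- The angle box `[0, 2π)^N` has Lebesgue measure `(2π)^N`. [folklore] -/
theorem volume_angleBox (N : ℕ) :
    volume (Set.univ.pi fun _ : Fin N => Set.Ico (0 : ℝ) (2 * Real.pi)) =
      ENNReal.ofReal ((2 * Real.pi) ^ N) := by
  rw [volume_pi_pi]
  simp only [Real.volume_Ico, sub_zero, Finset.prod_const, Finset.card_univ, Fintype.card_fin]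
  rw [ENNReal.ofReal_pow (by positivity)]

/-- `p_N ≤ 1` (the simple configurations form a subset of the angle box). [cite: MadrasSlade1993, §1.2] -/
theorem simpleProb_le_one (N : ℕ) : simpleProb N ≤ 1 := by
  have hpos : (0 : ℝ) < (2 * Real.pi) ^ N := by positivity
  rw [simpleProb, div_le_one hpos]
  have hsub : {θ : Fin N → ℝ | (∀ j, θ j ∈ Set.Ico (0 : ℝ) (2 * Real.pi)) ∧
      curveOf N (steps N θ) ∈ CurveClass.simple} ⊆
      Set.univ.pi fun _ : Fin N => Set.Ico (0 : ℝ) (2 * Real.pi) := by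
    rintro θ ⟨hθ, -⟩
    exact fun j _ => hθ j
  have h := measure_mono (μ := (volume : Measure (Fin N → ℝ))) hsub
  rw [volume_angleBox] at h
  calc _ ≤ (ENNReal.ofReal ((2 * Real.pi) ^ N)).toReal := ENNReal.toReal_mono ENNReal.ofReal_ne_top h
    _ = (2 * Real.pi) ^ N := ENNReal.toReal_ofReal hpos.le

/-- The family `p_{N+1}^{1/(N+1)}` is bounded below (by `0`). [folklore] -/
theorem bddBelow_range_simpleProb_rpow :
    BddBelow (Set.range fun N : ℕ => simpleProb (N + 1) ^ (1 / ((N : ℝ) + 1))) :=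
  ⟨0, by rintro _ ⟨N, rfl⟩; exact Real.rpow_nonneg (simpleProb_nonneg _) _⟩

/-- `0 ≤ μ_fjc`. [cite: MadrasSlade1993, §1.2] -/
theorem connectiveConstant_nonneg : 0 ≤ connectiveConstant :=
  le_ciInf fun _ => Real.rpow_nonneg (simpleProb_nonneg _) _

/-- `μ_fjc ≤ 1` (probabilities are at most `1`; compare `μ ≤ 2d - 1 < 2d` on `ℤ^d`,
Madras–Slade 1993, (1.1.3)). [cite: MadrasSlade1993, §1.2] -/
theorem connectiveConstant_le_one : connectiveConstant ≤ 1 := by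
  refine (ciInf_le bddBelow_range_simpleProb_rpow 0).trans ?_
  exact Real.rpow_le_one (simpleProb_nonneg _) (simpleProb_le_one _) (by positivity)

/-! ### The cone bound `p_N ≥ 4^{-N}`, hence `μ_fjc ≥ 1/4 > 0` -/

/-- One more step of the unit chain: `v_{k+1} = v_k + e^{iθ_k}`. [cite: BaumgartnerBinder1979, §II] -/
theorem steps_succ {N : ℕ} (θ : Fin N → ℝ) (k : Fin N) :
    steps N θ k.succ = steps N θ k.castSucc + Complex.exp (Complex.I * (θ k : ℂ)) := by
  have key : ∀ j : Fin N,
      (if (j : ℕ) < (k.succ : ℕ) then Complex.exp (Complex.I * (θ j : ℂ)) else 0) =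
        (if (j : ℕ) < (k.castSucc : ℕ) then Complex.exp (Complex.I * (θ j : ℂ)) else 0) +
          (if k = j then Complex.exp (Complex.I * (θ j : ℂ)) else 0) := by
    intro j
    simp only [Fin.val_succ, Fin.val_castSucc]
    by_cases hjk : (j : ℕ) < k
    · have hne : k ≠ j := fun h => by subst h; exact lt_irrefl _ hjk
      simp [hjk, hne, Nat.lt_succ_of_lt hjk]
    · by_cases hkj : k = j
      · subst hkj
        simp
      · have hn : ¬ (j : ℕ) < k + 1 := fun h => by
          rcases Nat.lt_succ_iff_lt_or_eq.1 h with h | h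
          · exact hjk h
          · exact hkj (Fin.ext h.symm)
        simp [hjk, hkj, hn]
  simp_rw [steps, key, Finset.sum_add_distrib, Finset.sum_ite_eq, Finset.mem_univ, if_true]

/-- The real part of the unit chain advances by `cos θ_k` at step `k`. [folklore] -/
theorem steps_succ_re {N : ℕ} (θ : Fin N → ℝ) (k : Fin N) :
    (steps N θ k.succ).re = (steps N θ k.castSucc).re + Real.cos (θ k) := by
  rw [steps_succ, Complex.add_re, mul_comm Complex.I, Complex.exp_ofReal_mul_I_re]

/-- **Cone configurations are non-crossing**: if all direction angles lie in `[0, π/2)`, the real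
parts of the vertices increase strictly, so the chain's polyline class is simple. [folklore] -/
theorem curveOf_steps_mem_simple {N : ℕ} {θ : Fin (N + 1) → ℝ}
    (hθ : ∀ j, θ j ∈ Set.Ico 0 (Real.pi / 2)) :
    curveOf (N + 1) (steps (N + 1) θ) ∈ CurveClass.simple := by
  refine mk_polyline_ofFn_mem_simple Complex.reLm _ fun k => ?_
  simp only [Complex.reLm_coe]
  rw [steps_succ_re]
  have := Real.cos_pos_of_mem_Ioo ⟨by linarith [(hθ k).1, Real.pi_pos], (hθ k).2⟩
  linarith

/-- The set of simple configurations has finite Lebesgue measure (it lies in the angle box).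
[folklore] -/
theorem volume_simpleConfigs_ne_top (N : ℕ) :
    volume {θ : Fin N → ℝ | (∀ j, θ j ∈ Set.Ico (0 : ℝ) (2 * Real.pi)) ∧
      curveOf N (steps N θ) ∈ CurveClass.simple} ≠ ∞ := by
  have hsub : {θ : Fin N → ℝ | (∀ j, θ j ∈ Set.Ico (0 : ℝ) (2 * Real.pi)) ∧
      curveOf N (steps N θ) ∈ CurveClass.simple} ⊆
      Set.univ.pi fun _ : Fin N => Set.Ico (0 : ℝ) (2 * Real.pi) := by
    rintro θ ⟨hθ, -⟩
    exact fun j _ => hθ j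
  have h := measure_mono (μ := (volume : Measure (Fin N → ℝ))) hsub
  rw [volume_angleBox] at h
  exact ne_top_of_le_ne_top ENNReal.ofReal_ne_top h

/-- **Cone bound**: `p_{N+1} ≥ 4^{-(N+1)}` — the configurations with all angles in `[0, π/2)`
(a quarter of the directions) are non-crossing. (Lattice analogue: `c_N ≥ d^N` by monotone
walks, Madras–Slade 1993, (1.1.3).) [cite: MadrasSlade1993, §1.1 eq. (1.1.3)] -/
theorem le_simpleProb_succ (N : ℕ) : (1 / 4 : ℝ) ^ (N + 1) ≤ simpleProb (N + 1) := by
  have hpos : (0 : ℝ) < (2 * Real.pi) ^ (N + 1) := by positivity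
  rw [simpleProb, le_div_iff₀ hpos]
  have hsub : (Set.univ.pi fun _ : Fin (N + 1) => Set.Ico (0 : ℝ) (Real.pi / 2)) ⊆
      {θ : Fin (N + 1) → ℝ | (∀ j, θ j ∈ Set.Ico (0 : ℝ) (2 * Real.pi)) ∧
        curveOf (N + 1) (steps (N + 1) θ) ∈ CurveClass.simple} := by
    intro θ hθ
    have hθ' : ∀ j, θ j ∈ Set.Ico (0 : ℝ) (Real.pi / 2) := fun j => hθ j (Set.mem_univ j)
    exact ⟨fun j => ⟨(hθ' j).1, (hθ' j).2.trans_le (by linarith [Real.pi_pos])⟩,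
      curveOf_steps_mem_simple hθ'⟩
  have h := measure_mono (μ := (volume : Measure (Fin (N + 1) → ℝ))) hsub
  have hbox : volume (Set.univ.pi fun _ : Fin (N + 1) => Set.Ico (0 : ℝ) (Real.pi / 2)) =
      ENNReal.ofReal ((Real.pi / 2) ^ (N + 1)) := by
    rw [volume_pi_pi]
    simp only [Real.volume_Ico, sub_zero, Finset.prod_const, Finset.card_univ, Fintype.card_fin]
    rw [ENNReal.ofReal_pow (by positivity)]
  rw [hbox] at h
  have h' := ENNReal.toReal_mono (volume_simpleConfigs_ne_top (N + 1)) h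
  rw [ENNReal.toReal_ofReal (by positivity)] at h'
  calc (1 / 4 : ℝ) ^ (N + 1) * (2 * Real.pi) ^ (N + 1) = (Real.pi / 2) ^ (N + 1) := by
        rw [← mul_pow]
        congr 1
        ring
    _ ≤ _ := h'

/-- **`μ_fjc ≥ 1/4`** (cone bound at every length, then `n`-th roots). [cite: MadrasSlade1993, §1.2] -/
theorem one_quarter_le_connectiveConstant : (1 / 4 : ℝ) ≤ connectiveConstant := by
  refine le_ciInf fun N => ?_
  have hexp : (1 / ((N : ℝ) + 1)) = ((N + 1 : ℕ) : ℝ)⁻¹ := by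
    push_cast
    ring
  calc (1 / 4 : ℝ) = ((1 / 4 : ℝ) ^ (N + 1)) ^ (1 / ((N : ℝ) + 1)) := by
        rw [hexp, Real.pow_rpow_inv_natCast (by norm_num) (Nat.succ_ne_zero N)]
    _ ≤ simpleProb (N + 1) ^ (1 / ((N : ℝ) + 1)) :=
        Real.rpow_le_rpow (by positivity) (le_simpleProb_succ N) (by positivity)

/-- **`μ_fjc > 0`**: the critical step fugacity `1/μ_fjc` of the freely-jointed non-crossing
chain is a genuine finite number. [cite: MadrasSlade1993, §1.2] -/
theorem connectiveConstant_pos : 0 < connectiveConstant :=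
  lt_of_lt_of_le (by norm_num) one_quarter_le_connectiveConstant

end FreelyJointedSAW

end Literature.Probability.RandomPlanarGeometry
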